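import Mathlib.Analysis.SpecialFunctions.Pow.Real
import HarnessLib

/-!
# Phase bookkeeping of the line `lip-agmon`: geometric bounds from the unipotent slot maps
(route `AnomalousDissipation/SawtoothPulseCascade`, crux ApproxSol58 = stmt-AnomalousDissipation-19688;
lead g4, module F-arith)

Pure real-variable lemmas (no PDE). Along the cascade, phase `j` has scale `s_j = s₀ σ^j`
(`σ = 2ρN`, `s₀ = N₀/δ₀`) and the response has the `L²` envelope `e_j = K ν (j+1) μ^{j+1}` (`μ < r`,
`σ ≤ μ`). The slot maps of `…LipAgmonShearSlot` make the phase-start sizes `z_j` (vorticity `L²`),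
`S₁,j` (first derivatives) and `S₂,j` (second derivatives) satisfy one-step inequalities
`x_{j+1} ≤ T x_j + (production)_j` with transport factors `T = 1`, `(1+γ)²`, `(1+γ+γ²)²` and
productions `≤ D ν (j+1) R^j`. The generic lemma `geom_bound_of_step` turns these into
`x_j ≤ (D/(R − T)) ν (j+1) R^j` (`T < R`); the ratios of the line are `R_Z = σμ`,
`R_W = σ²μ + (1+γ)²`, `R_V = σ³μ + σ(1+γ)² + (1+γ+γ²)²`.
-/

set_option linter.dupNamespace false

noncomputable section

namespace Summit.AnomalousDissipation.AnomalousDissipation.Theorems.SawtoothPulseCascade.LipAgmon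

open Finset

/-- **Geometric bound from a one-step inequality.** If `x₀ ≤ 0`… more precisely `x 0 ≤ B`, and
`x (j+1) ≤ T · x j + D (j+1) R^j` for all `j` with `0 ≤ T < R`, `0 ≤ D`, then for `B = D/(R − T)` (and any
`x 0 ≤ B`): `x j ≤ B (j+1) R^j` for all `j`. [folklore] -/
theorem geom_bound_of_step {x : ℕ → ℝ} {T R D : ℝ} (hT : 0 ≤ T) (hTR : T < R) (hD : 0 ≤ D)
    (h0 : x 0 ≤ D / (R - T)) (hstep : ∀ j : ℕ, x (j + 1) ≤ T * x j + D * ((j : ℝ) + 1) * R ^ j) :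
    ∀ j : ℕ, x j ≤ D / (R - T) * ((j : ℝ) + 1) * R ^ j := by
  have hRT : 0 < R - T := sub_pos.2 hTR
  have hR : 0 < R := hT.trans_lt hTR
  have hB : 0 ≤ D / (R - T) := div_nonneg hD hRT.le
  intro j
  induction j with
  | zero => simpa using h0
  | succ j ih =>
    have hj1 : (0 : ℝ) ≤ (j : ℝ) + 1 := by positivity
    have hRj : 0 ≤ R ^ j := pow_nonneg hR.le j
    have h1 := hstep j
    have h2 : T * x j ≤ T * (D / (R - T) * ((j : ℝ) + 1) * R ^ j) := mul_le_mul_of_nonneg_left ih hT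
    -- `T·B + D = B·R`
    have key : T * (D / (R - T)) + D = D / (R - T) * R := by
      field_simp
      ring
    calc x (j + 1) ≤ T * (D / (R - T) * ((j : ℝ) + 1) * R ^ j) + D * ((j : ℝ) + 1) * R ^ j := by linarith
      _ = (T * (D / (R - T)) + D) * ((j : ℝ) + 1) * R ^ j := by ring
      _ = D / (R - T) * R * ((j : ℝ) + 1) * R ^ j := by rw [key]
      _ ≤ D / (R - T) * R * (((j : ℝ) + 1) + 1) * R ^ j := by
          have : D / (R - T) * R * ((j : ℝ) + 1) ≤ D / (R - T) * R * (((j : ℝ) + 1) + 1) :=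
            mul_le_mul_of_nonneg_left (by linarith) (mul_nonneg hB hR.le)
          exact mul_le_mul_of_nonneg_right this hRj
      _ = D / (R - T) * ((((j + 1 : ℕ) : ℝ)) + 1) * R ^ (j + 1) := by
          push_cast
          ring

/-- A production term at the finer scale: `a · X^j ≤ a · R^j` for `0 ≤ X ≤ R`, `a ≥ 0`. [folklore] -/
theorem mul_pow_le_mul_pow {a X R : ℝ} (ha : 0 ≤ a) (hX : 0 ≤ X) (hXR : X ≤ R) (j : ℕ) :
    a * X ^ j ≤ a * R ^ j :=
  mul_le_mul_of_nonneg_left (pow_le_pow_left₀ hX hXR j) ha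

/-- `σ^(2j) ≤ (σμ)^j` for `0 ≤ σ ≤ μ`. [folklore] -/
theorem pow_two_mul_le {σ μ : ℝ} (hσ : 0 ≤ σ) (hσμ : σ ≤ μ) (j : ℕ) : σ ^ (2 * j) ≤ (σ * μ) ^ j := by
  rw [pow_mul, mul_pow, sq, mul_pow]
  exact mul_le_mul_of_nonneg_left (pow_le_pow_left₀ hσ hσμ j) (pow_nonneg hσ j)


/-! ## Monomial bookkeeping: scale `s_j = s₀σ^j`, envelope `e_j = Kν(j+1)μ^{j+1}` -/

section Monomials

variable {s₀ σ μ K ν : ℝ} {j : ℕ}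

/-- `s_j · e_j = (s₀Kμ) · ν(j+1) · (σμ)^j`. [folklore] -/
theorem scale_mul_env (s₀ σ μ K ν : ℝ) (j : ℕ) :
    (s₀ * σ ^ j) * (K * ν * ((j : ℝ) + 1) * μ ^ (j + 1)) =
      (s₀ * K * μ) * (ν * ((j : ℝ) + 1)) * (σ * μ) ^ j := by
  rw [mul_pow, pow_succ]; ring

/-- `s_j² · e_j = (s₀²Kμ) · ν(j+1) · (σ²μ)^j`. [folklore] -/
theorem scale_sq_mul_env (s₀ σ μ K ν : ℝ) (j : ℕ) :
    (s₀ * σ ^ j) ^ 2 * (K * ν * ((j : ℝ) + 1) * μ ^ (j + 1)) =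
      (s₀ ^ 2 * K * μ) * (ν * ((j : ℝ) + 1)) * (σ ^ 2 * μ) ^ j := by
  rw [mul_pow, mul_pow, pow_right_comm σ 2 j, pow_succ]; ring

/-- `s_j³ · e_j = (s₀³Kμ) · ν(j+1) · (σ³μ)^j`. [folklore] -/
theorem scale_cube_mul_env (s₀ σ μ K ν : ℝ) (j : ℕ) :
    (s₀ * σ ^ j) ^ 3 * (K * ν * ((j : ℝ) + 1) * μ ^ (j + 1)) =
      (s₀ ^ 3 * K * μ) * (ν * ((j : ℝ) + 1)) * (σ ^ 3 * μ) ^ j := by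
  rw [mul_pow, mul_pow, pow_right_comm σ 3 j, pow_succ]; ring

/-- `s_j · (A ν(j+1) X^j) = (s₀A) · ν(j+1) · (σX)^j`. [folklore] -/
theorem scale_mul_geom (s₀ σ A ν X : ℝ) (j : ℕ) :
    (s₀ * σ ^ j) * (A * (ν * ((j : ℝ) + 1)) * X ^ j) = (s₀ * A) * (ν * ((j : ℝ) + 1)) * (σ * X) ^ j := by
  rw [mul_pow]; ring

/-- `s_j² · (A ν(j+1) X^j) = (s₀²A) · ν(j+1) · (σ²X)^j`. [folklore] -/
theorem scale_sq_mul_geom (s₀ σ A ν X : ℝ) (j : ℕ) :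
    (s₀ * σ ^ j) ^ 2 * (A * (ν * ((j : ℝ) + 1)) * X ^ j) =
      (s₀ ^ 2 * A) * (ν * ((j : ℝ) + 1)) * (σ ^ 2 * X) ^ j := by
  rw [mul_pow, mul_pow, pow_right_comm σ 2 j]; ring

/-- The pure forcing terms: `ν · s_j^(m+1) ≤ s₀^(m+1) · ν(j+1) · (σ^m μ)^j` for `1 ≤ σ ≤ μ`, `ν ≥ 0`
(`σ^{(m+1)j} ≤ (σ^m μ)^j` and `1 ≤ j+1`). [folklore] -/
theorem forcing_term_le (hs₀ : 0 ≤ s₀) (hσ : 1 ≤ σ) (hσμ : σ ≤ μ) (hν : 0 ≤ ν) (m j : ℕ) :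
    ν * (s₀ * σ ^ j) ^ (m + 1) ≤ s₀ ^ (m + 1) * (ν * ((j : ℝ) + 1)) * (σ ^ m * μ) ^ j := by
  have hσ0 : 0 ≤ σ := zero_le_one.trans hσ
  have h1 : (σ ^ j) ^ (m + 1) ≤ (σ ^ m * μ) ^ j := by
    rw [← pow_mul, mul_comm j (m + 1), pow_mul, pow_succ]
    exact pow_le_pow_left₀ (by positivity) (mul_le_mul_of_nonneg_left hσμ (pow_nonneg hσ0 m)) j
  have h2 : ν ≤ ν * ((j : ℝ) + 1) := by
    have : (1 : ℝ) ≤ (j : ℝ) + 1 := by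
      have : (0 : ℝ) ≤ j := Nat.cast_nonneg j
      linarith
    nlinarith
  rw [mul_pow]
  have h3 : 0 ≤ s₀ ^ (m + 1) := pow_nonneg hs₀ _
  have h4 : 0 ≤ (σ ^ m * μ) ^ j := pow_nonneg (mul_nonneg (pow_nonneg hσ0 m) (hσ0.trans hσμ)) j
  calc ν * (s₀ ^ (m + 1) * (σ ^ j) ^ (m + 1)) = s₀ ^ (m + 1) * ν * (σ ^ j) ^ (m + 1) := by ring
    _ ≤ s₀ ^ (m + 1) * ν * (σ ^ m * μ) ^ j := mul_le_mul_of_nonneg_left h1 (mul_nonneg h3 hν)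
    _ ≤ s₀ ^ (m + 1) * (ν * ((j : ℝ) + 1)) * (σ ^ m * μ) ^ j := by
        have := mul_le_mul_of_nonneg_left h2 h3
        exact mul_le_mul_of_nonneg_right (by linarith) h4

/-- Coarsening the ratio: `c · ν(j+1) · Y^j ≤ c · ν(j+1) · R^j` for `0 ≤ Y ≤ R`, `c, ν ≥ 0`. [folklore] -/
theorem coef_geom_mono {c Y R : ℝ} (hc : 0 ≤ c) (hν : 0 ≤ ν) (hY : 0 ≤ Y) (hYR : Y ≤ R) (j : ℕ) :
    c * (ν * ((j : ℝ) + 1)) * Y ^ j ≤ c * (ν * ((j : ℝ) + 1)) * R ^ j :=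
  mul_le_mul_of_nonneg_left (pow_le_pow_left₀ hY hYR j) (mul_nonneg hc (mul_nonneg hν (by positivity)))

end Monomials


/-! ## Slot-output bounds at the three levels -/

section SlotBounds

variable {γ K μ σ s₀ c₂ c₃ c₄ c₅ ν : ℝ} {j : ℕ}

/-- **Level 0 (vorticity `L²`).** If the slot-start size is `≤ A·ν(j+1)·(σμ)^j` then the slot output
`a₀ + γ s_j (c₂ e_j + c₃ ν s_j)` is `≤ (A + γ(c₂s₀Kμ + c₃s₀²))·ν(j+1)·(σμ)^j`. [folklore] -/
theorem slot_zero_bound (hγ : 0 ≤ γ) (hσ : 1 ≤ σ) (hσμ : σ ≤ μ) (hs₀ : 0 ≤ s₀)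
    (hc₃ : 0 ≤ c₃) (hν : 0 ≤ ν) {a₀ A : ℝ}
    (ha : a₀ ≤ A * (ν * ((j : ℝ) + 1)) * (σ * μ) ^ j) :
    a₀ + γ * (s₀ * σ ^ j) * (c₂ * (K * ν * ((j : ℝ) + 1) * μ ^ (j + 1)) + c₃ * ν * (s₀ * σ ^ j)) ≤
      (A + γ * (c₂ * (s₀ * K * μ) + c₃ * s₀ ^ 2)) * (ν * ((j : ℝ) + 1)) * (σ * μ) ^ j := by
  have h1 : (s₀ * σ ^ j) * (K * ν * ((j : ℝ) + 1) * μ ^ (j + 1)) =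
      (s₀ * K * μ) * (ν * ((j : ℝ) + 1)) * (σ * μ) ^ j := scale_mul_env s₀ σ μ K ν j
  have h2 : ν * (s₀ * σ ^ j) ^ (1 + 1) ≤ s₀ ^ (1 + 1) * (ν * ((j : ℝ) + 1)) * (σ ^ 1 * μ) ^ j :=
    forcing_term_le hs₀ hσ hσμ hν 1 j
  simp only [pow_one] at h2
  have e1 : γ * (s₀ * σ ^ j) * (c₂ * (K * ν * ((j : ℝ) + 1) * μ ^ (j + 1)) + c₃ * ν * (s₀ * σ ^ j)) =
      γ * c₂ * ((s₀ * σ ^ j) * (K * ν * ((j : ℝ) + 1) * μ ^ (j + 1))) +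
        γ * c₃ * (ν * (s₀ * σ ^ j) ^ 2) := by ring
  rw [e1, h1]
  have h3 : γ * c₃ * (ν * (s₀ * σ ^ j) ^ 2) ≤ γ * c₃ * (s₀ ^ 2 * (ν * ((j : ℝ) + 1)) * (σ * μ) ^ j) :=
    mul_le_mul_of_nonneg_left h2 (mul_nonneg hγ hc₃)
  nlinarith

/-- The ratio facts of the line: `σ²μ ≤ R_W`, `σ³μ ≤ σ R_W ≤ R_V` with `R_W = σ²μ + (1+γ)²`,
`R_V = σ R_W + (1+γ+γ²)²`. [folklore] -/
theorem ratio_facts (hσ : 1 ≤ σ) (γ : ℝ) :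
    σ ^ 2 * μ ≤ σ ^ 2 * μ + (1 + γ) ^ 2 ∧
      σ ^ 3 * μ ≤ σ * (σ ^ 2 * μ + (1 + γ) ^ 2) ∧
      σ * (σ ^ 2 * μ + (1 + γ) ^ 2) ≤ σ * (σ ^ 2 * μ + (1 + γ) ^ 2) + (1 + γ + γ ^ 2) ^ 2 := by
  have hσ0 : 0 ≤ σ := zero_le_one.trans hσ
  refine ⟨by nlinarith [sq_nonneg (1 + γ)], ?_, by nlinarith [sq_nonneg (1 + γ + γ ^ 2)]⟩
  nlinarith [sq_nonneg (1 + γ), mul_nonneg hσ0 (sq_nonneg (1 + γ))]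

/-- **Level 1 (first derivatives).** With `R_W = σ²μ + (1+γ)²`: if the slot-start size is
`a₁ ≤ A₁·ν(j+1)·R_W^j` and the slot's level-0 bound is `z ≤ Z·ν(j+1)·(σμ)^j`, then the slot output
`(1+γ)a₁ + γ(1+γ)c₂ s z + γ(c₃ s² e + c₂ s z + c₄ ν s³)` is `≤ B·ν(j+1)·R_W^j` with
`B = (1+γ)A₁ + γ(1+γ)c₂s₀Z + γ(c₃s₀²Kμ + c₂s₀Z + c₄s₀³)`. [folklore] -/
theorem slot_one_bound (hγ : 0 ≤ γ) (hK : 0 ≤ K) (hσ : 1 ≤ σ) (hσμ : σ ≤ μ) (hs₀ : 0 ≤ s₀)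
    (hc₂ : 0 ≤ c₂) (hc₃ : 0 ≤ c₃) (hc₄ : 0 ≤ c₄) (hν : 0 ≤ ν) {a₁ A₁ z Z : ℝ} (hZ : 0 ≤ Z)
    (ha : a₁ ≤ A₁ * (ν * ((j : ℝ) + 1)) * (σ ^ 2 * μ + (1 + γ) ^ 2) ^ j)
    (hz : z ≤ Z * (ν * ((j : ℝ) + 1)) * (σ * μ) ^ j) :
    (1 + γ) * a₁ + γ * (1 + γ) * c₂ * (s₀ * σ ^ j) * z +
        γ * (c₃ * (s₀ * σ ^ j) ^ 2 * (K * ν * ((j : ℝ) + 1) * μ ^ (j + 1)) + c₂ * (s₀ * σ ^ j) * z +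
          c₄ * ν * (s₀ * σ ^ j) ^ 3) ≤
      ((1 + γ) * A₁ + γ * (1 + γ) * c₂ * s₀ * Z + γ * (c₃ * (s₀ ^ 2 * K * μ) + c₂ * s₀ * Z + c₄ * s₀ ^ 3)) *
        (ν * ((j : ℝ) + 1)) * (σ ^ 2 * μ + (1 + γ) ^ 2) ^ j := by
  obtain ⟨r1, r2, r3⟩ := ratio_facts hσ γ
  have hσ0 : 0 ≤ σ := zero_le_one.trans hσ
  have hμ0 : 0 ≤ μ := hσ0.trans hσμ
  have hu : 0 ≤ ν * ((j : ℝ) + 1) := mul_nonneg hν (by positivity)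
  have hs : 0 ≤ s₀ * σ ^ j := mul_nonneg hs₀ (pow_nonneg hσ0 j)
  set RW := σ ^ 2 * μ + (1 + γ) ^ 2 with hRW
  have hX0 : 0 ≤ σ ^ 2 * μ := by positivity
  -- `s·z ≤ s₀ Z ν(j+1) (σ²μ)^j ≤ s₀ Z ν(j+1) R_W^j`
  have t1 : (s₀ * σ ^ j) * z ≤ (s₀ * Z) * (ν * ((j : ℝ) + 1)) * RW ^ j := by
    have h1 : (s₀ * σ ^ j) * z ≤ (s₀ * σ ^ j) * (Z * (ν * ((j : ℝ) + 1)) * (σ * μ) ^ j) :=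
      mul_le_mul_of_nonneg_left hz hs
    rw [scale_mul_geom s₀ σ Z ν (σ * μ) j] at h1
    have hY : σ * (σ * μ) ≤ RW := by rw [hRW]; nlinarith [sq_nonneg (1 + γ)]
    have h2 := coef_geom_mono (c := s₀ * Z) (R := RW) (mul_nonneg hs₀ hZ) hν (Y := σ * (σ * μ))
      (by positivity) hY j
    exact h1.trans h2
  -- `s²·e = s₀²Kμ ν(j+1) (σ²μ)^j ≤ … R_W^j`
  have t2 : (s₀ * σ ^ j) ^ 2 * (K * ν * ((j : ℝ) + 1) * μ ^ (j + 1)) ≤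
      (s₀ ^ 2 * K * μ) * (ν * ((j : ℝ) + 1)) * RW ^ j := by
    rw [scale_sq_mul_env s₀ σ μ K ν j]
    exact coef_geom_mono (by positivity) hν hX0 r1 j
  -- `ν·s³ ≤ s₀³ ν(j+1) (σ²μ)^j ≤ … R_W^j`
  have t3 : ν * (s₀ * σ ^ j) ^ 3 ≤ s₀ ^ 3 * (ν * ((j : ℝ) + 1)) * RW ^ j := by
    have h1 : ν * (s₀ * σ ^ j) ^ (2 + 1) ≤ s₀ ^ (2 + 1) * (ν * ((j : ℝ) + 1)) * (σ ^ 2 * μ) ^ j :=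
      forcing_term_le hs₀ hσ hσμ hν 2 j
    exact h1.trans (coef_geom_mono (pow_nonneg hs₀ 3) hν hX0 r1 j)
  -- assemble
  have hRWj : 0 ≤ RW ^ j := pow_nonneg (by positivity) j
  have ha' : (1 + γ) * a₁ ≤ (1 + γ) * (A₁ * (ν * ((j : ℝ) + 1)) * RW ^ j) :=
    mul_le_mul_of_nonneg_left ha (by linarith)
  have e : (1 + γ) * a₁ + γ * (1 + γ) * c₂ * (s₀ * σ ^ j) * z +
      γ * (c₃ * (s₀ * σ ^ j) ^ 2 * (K * ν * ((j : ℝ) + 1) * μ ^ (j + 1)) + c₂ * (s₀ * σ ^ j) * z +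
        c₄ * ν * (s₀ * σ ^ j) ^ 3) =
      (1 + γ) * a₁ + γ * (1 + γ) * c₂ * ((s₀ * σ ^ j) * z) +
        γ * (c₃ * ((s₀ * σ ^ j) ^ 2 * (K * ν * ((j : ℝ) + 1) * μ ^ (j + 1))) + c₂ * ((s₀ * σ ^ j) * z) +
          c₄ * (ν * (s₀ * σ ^ j) ^ 3)) := by ring
  rw [e]
  have i1 := mul_le_mul_of_nonneg_left t1 (show 0 ≤ γ * (1 + γ) * c₂ by positivity)
  have i2 := mul_le_mul_of_nonneg_left t2 hc₃
  have i3 := mul_le_mul_of_nonneg_left t1 hc₂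
  have i4 := mul_le_mul_of_nonneg_left t3 hc₄
  nlinarith


/-- **Level 2 (second derivatives).** With `R_W = σ²μ + (1+γ)²`, `R_V = σR_W + (1+γ+γ²)²`: if the
slot-start sizes are `a₂ ≤ A₂·ν(j+1)·R_V^j`, `a₁ ≤ A₁·ν(j+1)·R_W^j`, the slot's level-0 bound is
`z ≤ Z·ν(j+1)·(σμ)^j` and its level-1 output bound is `S ≤ S̄·ν(j+1)·R_W^j`, then the slot's level-2 output
`(1+γ+γ²)(a₂ + γc₂ s S + γ(c₃ s² z + c₂ s S) + γ(c₄ s³ e + 2c₃ s² z + c₂ s S + c₅ ν s⁴)) + γc₂ s (a₁ + γc₂ s z)`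
is `≤ B·ν(j+1)·R_V^j` with the displayed `B`. [folklore] -/
theorem slot_two_bound (hγ : 0 ≤ γ) (hK : 0 ≤ K) (hσ : 1 ≤ σ) (hσμ : σ ≤ μ) (hs₀ : 0 ≤ s₀)
    (hc₂ : 0 ≤ c₂) (hc₃ : 0 ≤ c₃) (hc₄ : 0 ≤ c₄) (hc₅ : 0 ≤ c₅) (hν : 0 ≤ ν)
    {a₁ A₁ a₂ A₂ z Z S Sb : ℝ} (hA₁ : 0 ≤ A₁) (hZ : 0 ≤ Z) (hSb : 0 ≤ Sb)
    (ha₂ : a₂ ≤ A₂ * (ν * ((j : ℝ) + 1)) * (σ * (σ ^ 2 * μ + (1 + γ) ^ 2) + (1 + γ + γ ^ 2) ^ 2) ^ j)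
    (ha₁ : a₁ ≤ A₁ * (ν * ((j : ℝ) + 1)) * (σ ^ 2 * μ + (1 + γ) ^ 2) ^ j)
    (hz : z ≤ Z * (ν * ((j : ℝ) + 1)) * (σ * μ) ^ j)
    (hS : S ≤ Sb * (ν * ((j : ℝ) + 1)) * (σ ^ 2 * μ + (1 + γ) ^ 2) ^ j) :
    (1 + γ + γ ^ 2) * (a₂ + γ * c₂ * (s₀ * σ ^ j) * S +
        γ * (c₃ * (s₀ * σ ^ j) ^ 2 * z + c₂ * (s₀ * σ ^ j) * S) +
        γ * (c₄ * (s₀ * σ ^ j) ^ 3 * (K * ν * ((j : ℝ) + 1) * μ ^ (j + 1)) + 2 * c₃ * (s₀ * σ ^ j) ^ 2 * z +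
          c₂ * (s₀ * σ ^ j) * S + c₅ * ν * (s₀ * σ ^ j) ^ 4)) +
      γ * c₂ * (s₀ * σ ^ j) * (a₁ + γ * c₂ * (s₀ * σ ^ j) * z) ≤
      ((1 + γ + γ ^ 2) * (A₂ + γ * c₂ * s₀ * Sb + γ * (c₃ * s₀ ^ 2 * Z + c₂ * s₀ * Sb) +
          γ * (c₄ * (s₀ ^ 3 * K * μ) + 2 * c₃ * s₀ ^ 2 * Z + c₂ * s₀ * Sb + c₅ * s₀ ^ 4)) +
        γ * c₂ * (s₀ * A₁ + γ * c₂ * s₀ ^ 2 * Z)) *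
        (ν * ((j : ℝ) + 1)) * (σ * (σ ^ 2 * μ + (1 + γ) ^ 2) + (1 + γ + γ ^ 2) ^ 2) ^ j := by
  obtain ⟨r1, r2, r3⟩ := ratio_facts hσ γ
  have hσ0 : 0 ≤ σ := zero_le_one.trans hσ
  have hμ0 : 0 ≤ μ := hσ0.trans hσμ
  have hu : 0 ≤ ν * ((j : ℝ) + 1) := mul_nonneg hν (by positivity)
  have hs : 0 ≤ s₀ * σ ^ j := mul_nonneg hs₀ (pow_nonneg hσ0 j)
  set RW := σ ^ 2 * μ + (1 + γ) ^ 2 with hRW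
  set RV := σ * RW + (1 + γ + γ ^ 2) ^ 2 with hRV
  have hRW0 : 0 ≤ RW := by positivity
  have hX3 : 0 ≤ σ ^ 3 * μ := by positivity
  have r23 : σ ^ 3 * μ ≤ RV := r2.trans r3
  -- `s·S ≤ s₀ S̄ · unit · (σ R_W)^j ≤ … R_V^j`
  have ta : (s₀ * σ ^ j) * S ≤ (s₀ * Sb) * (ν * ((j : ℝ) + 1)) * RV ^ j := by
    have h1 : (s₀ * σ ^ j) * S ≤ (s₀ * σ ^ j) * (Sb * (ν * ((j : ℝ) + 1)) * RW ^ j) :=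
      mul_le_mul_of_nonneg_left hS hs
    rw [scale_mul_geom s₀ σ Sb ν RW j] at h1
    exact h1.trans (coef_geom_mono (mul_nonneg hs₀ hSb) hν (by positivity) r3 j)
  -- `s·a₁ ≤ s₀ A₁ · unit · (σ R_W)^j ≤ … R_V^j`
  have te : (s₀ * σ ^ j) * a₁ ≤ (s₀ * A₁) * (ν * ((j : ℝ) + 1)) * RV ^ j := by
    have h1 : (s₀ * σ ^ j) * a₁ ≤ (s₀ * σ ^ j) * (A₁ * (ν * ((j : ℝ) + 1)) * RW ^ j) :=
      mul_le_mul_of_nonneg_left ha₁ hs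
    rw [scale_mul_geom s₀ σ A₁ ν RW j] at h1
    exact h1.trans (coef_geom_mono (mul_nonneg hs₀ hA₁) hν (by positivity) r3 j)
  -- `s²·z ≤ s₀² Z · unit · (σ³μ)^j ≤ … R_V^j`
  have tb : (s₀ * σ ^ j) ^ 2 * z ≤ (s₀ ^ 2 * Z) * (ν * ((j : ℝ) + 1)) * RV ^ j := by
    have h1 : (s₀ * σ ^ j) ^ 2 * z ≤ (s₀ * σ ^ j) ^ 2 * (Z * (ν * ((j : ℝ) + 1)) * (σ * μ) ^ j) :=
      mul_le_mul_of_nonneg_left hz (pow_nonneg hs 2)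
    rw [scale_sq_mul_geom s₀ σ Z ν (σ * μ) j] at h1
    have e3 : σ ^ 2 * (σ * μ) = σ ^ 3 * μ := by ring
    rw [e3] at h1
    exact h1.trans (coef_geom_mono (by positivity) hν hX3 r23 j)
  -- `s³·e = s₀³Kμ · unit · (σ³μ)^j ≤ … R_V^j`
  have tc : (s₀ * σ ^ j) ^ 3 * (K * ν * ((j : ℝ) + 1) * μ ^ (j + 1)) ≤
      (s₀ ^ 3 * K * μ) * (ν * ((j : ℝ) + 1)) * RV ^ j := by
    rw [scale_cube_mul_env s₀ σ μ K ν j]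
    exact coef_geom_mono (by positivity) hν hX3 r23 j
  -- `ν·s⁴ ≤ s₀⁴ · unit · (σ³μ)^j ≤ … R_V^j`
  have td : ν * (s₀ * σ ^ j) ^ 4 ≤ s₀ ^ 4 * (ν * ((j : ℝ) + 1)) * RV ^ j := by
    have h1 : ν * (s₀ * σ ^ j) ^ (3 + 1) ≤ s₀ ^ (3 + 1) * (ν * ((j : ℝ) + 1)) * (σ ^ 3 * μ) ^ j :=
      forcing_term_le hs₀ hσ hσμ hν 3 j
    exact h1.trans (coef_geom_mono (pow_nonneg hs₀ 4) hν hX3 r23 j)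
  -- assemble
  have hRVj : 0 ≤ RV ^ j := pow_nonneg (by positivity) j
  have e : (1 + γ + γ ^ 2) * (a₂ + γ * c₂ * (s₀ * σ ^ j) * S +
        γ * (c₃ * (s₀ * σ ^ j) ^ 2 * z + c₂ * (s₀ * σ ^ j) * S) +
        γ * (c₄ * (s₀ * σ ^ j) ^ 3 * (K * ν * ((j : ℝ) + 1) * μ ^ (j + 1)) + 2 * c₃ * (s₀ * σ ^ j) ^ 2 * z +
          c₂ * (s₀ * σ ^ j) * S + c₅ * ν * (s₀ * σ ^ j) ^ 4)) +
      γ * c₂ * (s₀ * σ ^ j) * (a₁ + γ * c₂ * (s₀ * σ ^ j) * z) =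
      (1 + γ + γ ^ 2) * (a₂ + γ * c₂ * ((s₀ * σ ^ j) * S) +
        γ * (c₃ * ((s₀ * σ ^ j) ^ 2 * z) + c₂ * ((s₀ * σ ^ j) * S)) +
        γ * (c₄ * ((s₀ * σ ^ j) ^ 3 * (K * ν * ((j : ℝ) + 1) * μ ^ (j + 1))) + 2 * c₃ * ((s₀ * σ ^ j) ^ 2 * z) +
          c₂ * ((s₀ * σ ^ j) * S) + c₅ * (ν * (s₀ * σ ^ j) ^ 4))) +
      γ * c₂ * ((s₀ * σ ^ j) * a₁) + γ * c₂ * (γ * c₂) * ((s₀ * σ ^ j) ^ 2 * z) := by ring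
  rw [e]
  have hT : 0 ≤ 1 + γ + γ ^ 2 := by positivity
  set U := (ν * ((j : ℝ) + 1)) * RV ^ j with hU
  have hU0 : 0 ≤ U := mul_nonneg hu hRVj
  -- every term against its coefficient
  have ja : (1 + γ + γ ^ 2) * a₂ ≤ (1 + γ + γ ^ 2) * (A₂ * U) := by
    refine mul_le_mul_of_nonneg_left ?_ hT
    simpa [hU, mul_assoc] using ha₂
  have jTa : (1 + γ + γ ^ 2) * (γ * c₂) * ((s₀ * σ ^ j) * S) ≤ (1 + γ + γ ^ 2) * (γ * c₂) * ((s₀ * Sb) * U) := by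
    refine mul_le_mul_of_nonneg_left ?_ (by positivity)
    simpa [hU, mul_assoc] using ta
  have jTb : (1 + γ + γ ^ 2) * (γ * c₃) * ((s₀ * σ ^ j) ^ 2 * z) ≤ (1 + γ + γ ^ 2) * (γ * c₃) * ((s₀ ^ 2 * Z) * U) := by
    refine mul_le_mul_of_nonneg_left ?_ (by positivity)
    simpa [hU, mul_assoc] using tb
  have jTb' : (γ * c₂ * (γ * c₂)) * ((s₀ * σ ^ j) ^ 2 * z) ≤ (γ * c₂ * (γ * c₂)) * ((s₀ ^ 2 * Z) * U) := by
    refine mul_le_mul_of_nonneg_left ?_ (by positivity)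
    simpa [hU, mul_assoc] using tb
  have jTc : (1 + γ + γ ^ 2) * (γ * c₄) * ((s₀ * σ ^ j) ^ 3 * (K * ν * ((j : ℝ) + 1) * μ ^ (j + 1))) ≤
      (1 + γ + γ ^ 2) * (γ * c₄) * ((s₀ ^ 3 * K * μ) * U) := by
    refine mul_le_mul_of_nonneg_left ?_ (by positivity)
    simpa [hU, mul_assoc] using tc
  have jTd : (1 + γ + γ ^ 2) * (γ * c₅) * (ν * (s₀ * σ ^ j) ^ 4) ≤ (1 + γ + γ ^ 2) * (γ * c₅) * (s₀ ^ 4 * U) := by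
    refine mul_le_mul_of_nonneg_left ?_ (by positivity)
    simpa [hU, mul_assoc] using td
  have jTe : (γ * c₂) * ((s₀ * σ ^ j) * a₁) ≤ (γ * c₂) * ((s₀ * A₁) * U) := by
    refine mul_le_mul_of_nonneg_left ?_ (by positivity)
    simpa [hU, mul_assoc] using te
  -- the goal is the sum of the `j•` inequalities with weights `1, 3, 3, 1, 1, 1, 1`
  have goal_eq : (1 + γ + γ ^ 2) * (a₂ + γ * c₂ * ((s₀ * σ ^ j) * S) +
        γ * (c₃ * ((s₀ * σ ^ j) ^ 2 * z) + c₂ * ((s₀ * σ ^ j) * S)) +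
        γ * (c₄ * ((s₀ * σ ^ j) ^ 3 * (K * ν * ((j : ℝ) + 1) * μ ^ (j + 1))) + 2 * c₃ * ((s₀ * σ ^ j) ^ 2 * z) +
          c₂ * ((s₀ * σ ^ j) * S) + c₅ * (ν * (s₀ * σ ^ j) ^ 4))) +
      γ * c₂ * ((s₀ * σ ^ j) * a₁) + γ * c₂ * (γ * c₂) * ((s₀ * σ ^ j) ^ 2 * z) =
      (1 + γ + γ ^ 2) * a₂ + 3 * ((1 + γ + γ ^ 2) * (γ * c₂) * ((s₀ * σ ^ j) * S)) +
        3 * ((1 + γ + γ ^ 2) * (γ * c₃) * ((s₀ * σ ^ j) ^ 2 * z)) +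
        (1 + γ + γ ^ 2) * (γ * c₄) * ((s₀ * σ ^ j) ^ 3 * (K * ν * ((j : ℝ) + 1) * μ ^ (j + 1))) +
        (1 + γ + γ ^ 2) * (γ * c₅) * (ν * (s₀ * σ ^ j) ^ 4) +
        (γ * c₂) * ((s₀ * σ ^ j) * a₁) + (γ * c₂ * (γ * c₂)) * ((s₀ * σ ^ j) ^ 2 * z) := by ring
  have rhs_eq : ((1 + γ + γ ^ 2) * (A₂ + γ * c₂ * s₀ * Sb + γ * (c₃ * s₀ ^ 2 * Z + c₂ * s₀ * Sb) +
          γ * (c₄ * (s₀ ^ 3 * K * μ) + 2 * c₃ * s₀ ^ 2 * Z + c₂ * s₀ * Sb + c₅ * s₀ ^ 4)) +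
        γ * c₂ * (s₀ * A₁ + γ * c₂ * s₀ ^ 2 * Z)) * (ν * ((j : ℝ) + 1)) * RV ^ j =
      (1 + γ + γ ^ 2) * (A₂ * U) + 3 * ((1 + γ + γ ^ 2) * (γ * c₂) * ((s₀ * Sb) * U)) +
        3 * ((1 + γ + γ ^ 2) * (γ * c₃) * ((s₀ ^ 2 * Z) * U)) +
        (1 + γ + γ ^ 2) * (γ * c₄) * ((s₀ ^ 3 * K * μ) * U) +
        (1 + γ + γ ^ 2) * (γ * c₅) * (s₀ ^ 4 * U) +
        (γ * c₂) * ((s₀ * A₁) * U) + (γ * c₂ * (γ * c₂)) * ((s₀ ^ 2 * Z) * U) := by rw [hU]; ring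
  rw [goal_eq, rhs_eq]
  linarith

end SlotBounds



end Summit.AnomalousDissipation.AnomalousDissipation.Theorems.SawtoothPulseCascade.LipAgmon

end
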